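import Mathlib.Analysis.Normed.Group.Basic
import Mathlib.Algebra.BigOperators.Group.Finset.Basic
import Mathlib.Algebra.Order.BigOperators.Group.Finset
import Mathlib.Data.Real.Basic
import HarnessLib

/-!
# Route `UnitScaleTilt`, crux K1 «MinimiserStabilityRegPr» (stmt-QuantumFields-19200), stub `stub_existenceMinimalOrbit` (EX) — toward the displayed (157)-twˢ row `hC157` of S21ᴸ as a THEOREM
# («C-ENTRY LINE», px18 g3 LOCATE cc411499 + offer 2026-08-29T03:04Z), file F-1: **THE LEAKY LINEAR TOWER** (lattice-free) — the composed one-step linear parts of a CURVED tower applied to a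
# one-bond direction stay within a factor `1 + 4gθ ≤ 2` of the flat single-tube profile `λᵐα₀`, because the curvature leak at level `m` is `∝ θ^{k−m}` (GEOMETRICALLY SMALL toward the bottom,
# [Balaban1985Averaging] (52)∕(139): `α₀(Lʲη)²`) while the flat tube amplifies an off-tube leak by at most the reader multiplicity `Θ` per level (`Θθ ≤ ½`): print's (141)–(147)
# «|Q_j(U₀)A| ≦ Q_j|A| + 2C′₁α₀(Lʲη)²Q″_j|A| … |Q_k(U₀; c, b)| ≦ 1 + 2C′₁α₀» in sup-norm bookkeeping

Cell `ym3-torus` (HUMAN RULING D-0037: YM₃ on the torus is ladder rung R3 — not d = 4, not a mass gap, not Clay), width seat `ym3-torus-px18` (gen 3).  `--supports stmt-QuantumFields-19200 --as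
helper`; Mathlib-only, def-free, 0 sorry; count-neutral.  It supplies the hypothesis `ha : ‖a_m c′‖ ≤ α_m` (`α_{m+1} = λα_m` EXACT) of ✓`ChartKernelTower.kernel_tower_bound_le` (p610533) for a
curved tower whose one-step linear parts are «flat tube + small leak» (✓`Prop7DbarJointAnalytic.norm_fderiv_dbarSlice_sub_fderiv_flat_le`, ★routeR-w3 g7).  Nothing of EX, the stub, the crux,
d = 4 or the mass gap is claimed; no lattice object appears.

THE PRINT.  [Balaban1985Averaging] p. 39–40: «|Q_{V₀}A| ≦ Q|A|, |Q″(V₀)A| ≦ C′₁L²α₀Q″|A| (139) … |Q_j(U₀)A| ≦ Q_j|A| + 2C′₁α₀(Lʲη)²Q″_j|A|, j ≦ k (143) … |Q_{j+1}(U₀)A| = |Q(Ū₀ʲ)Q_j(U₀)A| ≦ Q|Q_j(U₀)A| +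
C′₁2α₀(Lʲη)²Q″|Q_j(U₀)A| (144) … |Q_k(U₀; c, b)| ≦ 1 + 2C′₁α₀ (147)».  Here: `a_{m+1} = T_m a_m`, `T_m = T♭_m + R_m`, the flat orbit `e_{m+1} = T♭_m e_m` with `‖e_m‖ ≤ λᵐα₀` (print's `Q_j|A|`
on a one-bond `A`), the leak `r_m := a_m − e_m` with `r_{m+1} = T♭_m r_m + R_m a_m`, and the letters `‖T♭_m w c‖ ≤ Θλ·sup_S‖w‖`, `‖R_m w c‖ ≤ c_m·Σ_S‖w‖`, `c_m·|S_m| ≤ λ·g·θ^{k−m}`.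

WHAT IS PROVED (ns `…Theorems.LeakyLinearTower`; finite reader sets `S_m`, values in a seminormed group `𝔸`).
* §1 `leak_profile_step` — scalar: `Θθ ≤ ½`, `4gθ ≤ 1`, `ρ ≤ 4gθ^{k+1−m}λᵐα₀` ⇒ `Θλρ + λgθ^{k−m}(λᵐα₀ + ρ) ≤ 4gθ^{k−m}λ^{m+1}α₀`; `leak_profile_le` (the induction over `m ≤ k`).
* §2 `leak_step_bound` — one level, vectors: from `r′ c = T♭ r c + R a c`, the two letters, `|S| ≤ ν`, `a = e + r` on `S` with `‖e‖ ≤ α`, `‖r‖ ≤ ρ` there: `‖r′ c‖ ≤ Θλ·ρ + c·ν·(α + ρ)`.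
* §3 ★★★ `leaky_tower_bound` — for all `m ≤ k`: `‖r_m c‖ ≤ 4g·θ^{k+1−m}·λᵐα₀` and `‖a_m c‖ ≤ (1 + 4gθ)·λᵐα₀`; ★★ `leaky_tower_bound_two` (`‖a_m c‖ ≤ 2λᵐα₀` — the `ha` of ✓`kernel_tower_bound_le`
  at `α_m := 2λᵐα₀`).
HONEST SCOPE.  Arithmetic and one triangle inequality per level; the instantiation (flat tube exact on a one-bond delta ✓`ChartKernelTube`, leak letter ✓p689987, `θ = L⁻²`, `Θ = 2`,
`λ = L^{1−d}`, `g ∝ ε₀·L²`) is file F-2 of the line.  Nothing of the paper is asserted.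

References: T. Bałaban, CMP **98** (1985) 17–51 [Balaban1985Averaging] ((52) p.26, (139)–(147) pp.39–40).
-/

set_option autoImplicit false

open scoped BigOperators

namespace Summit.QuantumFields.YangMills.Theorems.LeakyLinearTower

/-! ## §1 The scalar leak profile -/

/-- **ONE STEP OF THE LEAK PROFILE**: with `Θθ ≤ ½`, `4gθ ≤ 1`, `0 ≤ g, θ, λ, α₀`, `θ ≤ 1`, `m ≤ k` and `ρ ≤ 4g·θ^{k+1−m}·λᵐα₀`,
`Θλ·ρ + λ·g·θ^{k−m}·(λᵐα₀ + ρ) ≤ 4g·θ^{k−m}·λ^{m+1}·α₀`. [cite: Balaban1985Averaging, (144)–(145) p.40] -/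
theorem leak_profile_step {Θ θ g lam α₀ ρ : ℝ} {k m : ℕ} (hΘ : 0 ≤ Θ) (hθ : 0 ≤ θ) (hθ1 : θ ≤ 1) (hg : 0 ≤ g) (hlam : 0 ≤ lam) (hα₀ : 0 ≤ α₀)
    (hΘθ : Θ * θ ≤ 1 / 2) (hgθ : 4 * g * θ ≤ 1) (hm : m ≤ k) (hρ : ρ ≤ 4 * g * θ ^ (k + 1 - m) * lam ^ m * α₀) :
    Θ * lam * ρ + lam * g * θ ^ (k - m) * (lam ^ m * α₀ + ρ) ≤ 4 * g * θ ^ (k - m) * lam ^ (m + 1) * α₀ := by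
  have hkm : k + 1 - m = (k - m) + 1 := by omega
  rw [hkm, pow_succ] at hρ
  set P : ℝ := θ ^ (k - m) with hP
  have hP0 : 0 ≤ P := pow_nonneg hθ _
  have hP1 : P ≤ 1 := pow_le_one₀ hθ hθ1
  have hL0 : 0 ≤ lam ^ m := pow_nonneg hlam _
  -- `ρ ≤ 4g·P·θ·λᵐα₀`, hence `Θλρ ≤ Θθ·4gPλ^{m+1}α₀ ≤ 2gPλ^{m+1}α₀` and `λgP·ρ ≤ λgP·(4gθ)·P·λᵐα₀ ≤ gPλ^{m+1}α₀`
  have h1 : Θ * lam * ρ ≤ 2 * g * P * lam ^ (m + 1) * α₀ := by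
    have := mul_le_mul_of_nonneg_left hρ (mul_nonneg hΘ hlam)
    have e1 : Θ * lam * (4 * g * (P * θ) * lam ^ m * α₀) = (Θ * θ) * (4 * g * P * lam ^ (m + 1) * α₀) := by rw [pow_succ]; ring
    rw [e1] at this
    have h2 : (Θ * θ) * (4 * g * P * lam ^ (m + 1) * α₀) ≤ (1 / 2) * (4 * g * P * lam ^ (m + 1) * α₀) :=
      mul_le_mul_of_nonneg_right hΘθ (by positivity)
    linarith
  have h2 : lam * g * P * ρ ≤ g * P * lam ^ (m + 1) * α₀ * P := by
    have := mul_le_mul_of_nonneg_left hρ (by positivity : 0 ≤ lam * g * P)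
    have e1 : lam * g * P * (4 * g * (P * θ) * lam ^ m * α₀) = (4 * g * θ) * (g * P * lam ^ (m + 1) * α₀ * P) := by rw [pow_succ]; ring
    rw [e1] at this
    have h3 : (4 * g * θ) * (g * P * lam ^ (m + 1) * α₀ * P) ≤ 1 * (g * P * lam ^ (m + 1) * α₀ * P) := mul_le_mul_of_nonneg_right hgθ (by positivity)
    linarith
  have h3 : g * P * lam ^ (m + 1) * α₀ * P ≤ g * P * lam ^ (m + 1) * α₀ := by
    have := mul_le_mul_of_nonneg_left hP1 (by positivity : 0 ≤ g * P * lam ^ (m + 1) * α₀); linarith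
  have e2 : lam * g * P * (lam ^ m * α₀ + ρ) = g * P * lam ^ (m + 1) * α₀ + lam * g * P * ρ := by rw [pow_succ]; ring
  rw [e2]
  linarith

/-- ★ **THE LEAK PROFILE BY INDUCTION**: `ρ_0 = 0`, `ρ_{m+1} ≤ Θλρ_m + λgθ^{k−m}(λᵐα₀ + ρ_m)` for `m < k` ⇒ `ρ_m ≤ 4gθ^{k+1−m}λᵐα₀` for all `m ≤ k`.
[cite: Balaban1985Averaging, (143)–(145) p.40] -/
theorem leak_profile_le {Θ θ g lam α₀ : ℝ} {k : ℕ} (ρ : ℕ → ℝ) (hΘ : 0 ≤ Θ) (hθ : 0 ≤ θ) (hθ1 : θ ≤ 1) (hg : 0 ≤ g) (hlam : 0 ≤ lam) (hα₀ : 0 ≤ α₀)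
    (hΘθ : Θ * θ ≤ 1 / 2) (hgθ : 4 * g * θ ≤ 1) (hρ0 : ρ 0 = 0)
    (hrec : ∀ m, m < k → ρ (m + 1) ≤ Θ * lam * ρ m + lam * g * θ ^ (k - m) * (lam ^ m * α₀ + ρ m)) :
    ∀ m, m ≤ k → ρ m ≤ 4 * g * θ ^ (k + 1 - m) * lam ^ m * α₀ := by
  intro m
  induction m with
  | zero => intro _; rw [hρ0]; positivity
  | succ m ih =>
    intro hm
    have hm' : m < k := Nat.lt_of_succ_le hm
    have h := leak_profile_step hΘ hθ hθ1 hg hlam hα₀ hΘθ hgθ hm'.le (ih hm'.le)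
    have hk : k + 1 - (m + 1) = k - m := by omega
    rw [hk]
    exact (hrec m hm').trans h

/-! ## §2 One level: the leak recursion in vectors -/

section Step

variable {ι ι' : Type*} {𝔸 : Type*} [SeminormedAddCommGroup 𝔸]

/-- **ONE LEVEL OF THE LEAK** ((144) in sup-norm bookkeeping): if `r′ c = T♭ r c + R a c`, the flat tube satisfies `‖T♭ w c‖ ≤ Θλ·β` for `w` vanishing off `S` with `‖w‖ ≤ β` on `S`, the leak
satisfies `‖R w c‖ ≤ cR·Σ_{c′∈S}‖w c′‖` for `w` vanishing off `S`, `|S| ≤ ν`, and on `S` the input splits as `a = e + r` with `‖e c′‖ ≤ α`, `‖r c′‖ ≤ ρ` (all three vanishing off `S`), then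
`‖r′ c‖ ≤ Θλ·ρ + cR·ν·(α + ρ)`. [cite: Balaban1985Averaging, (144) p.40] -/
theorem leak_step_bound (S : Finset ι) (Tf R : (ι → 𝔸) → ι' → 𝔸) (a e r : ι → 𝔸) (r' : ι' → 𝔸) (c : ι')
    {Θ lam cR α ρ : ℝ} {ν : ℕ} (hcR : 0 ≤ cR) (hα : 0 ≤ α) (hρ : 0 ≤ ρ)
    (hrec : r' c = Tf r c + R a c)
    (hT : ∀ (w : ι → 𝔸) (β : ℝ), 0 ≤ β → (∀ c', c' ∉ S → w c' = 0) → (∀ c' ∈ S, ‖w c'‖ ≤ β) → ‖Tf w c‖ ≤ Θ * lam * β)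
    (hR : ∀ w : ι → 𝔸, (∀ c', c' ∉ S → w c' = 0) → ‖R w c‖ ≤ cR * ∑ c' ∈ S, ‖w c'‖)
    (hcard : S.card ≤ ν) (hae : ∀ c', a c' = e c' + r c')
    (hSe : ∀ c', c' ∉ S → e c' = 0) (hSr : ∀ c', c' ∉ S → r c' = 0)
    (he : ∀ c' ∈ S, ‖e c'‖ ≤ α) (hr : ∀ c' ∈ S, ‖r c'‖ ≤ ρ) :
    ‖r' c‖ ≤ Θ * lam * ρ + cR * ν * (α + ρ) := by
  have hSa : ∀ c', c' ∉ S → a c' = 0 := fun c' hc' => by rw [hae c', hSe c' hc', hSr c' hc', add_zero]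
  have h1 : ‖Tf r c‖ ≤ Θ * lam * ρ := hT r ρ hρ hSr hr
  have h2 : ‖R a c‖ ≤ cR * ∑ c' ∈ S, ‖a c'‖ := hR a hSa
  have h3 : ∑ c' ∈ S, ‖a c'‖ ≤ ν * (α + ρ) := by
    calc ∑ c' ∈ S, ‖a c'‖ ≤ ∑ c' ∈ S, (α + ρ) := Finset.sum_le_sum fun c' hc' => by
            rw [hae c']; exact (norm_add_le _ _).trans (add_le_add (he c' hc') (hr c' hc'))
      _ = S.card * (α + ρ) := by rw [Finset.sum_const, nsmul_eq_mul]
      _ ≤ ν * (α + ρ) := mul_le_mul_of_nonneg_right (by exact_mod_cast hcard) (add_nonneg hα hρ)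
  rw [hrec]
  calc ‖Tf r c + R a c‖ ≤ ‖Tf r c‖ + ‖R a c‖ := norm_add_le _ _
    _ ≤ Θ * lam * ρ + cR * (ν * (α + ρ)) := add_le_add h1 (h2.trans (mul_le_mul_of_nonneg_left h3 hcR))
    _ = Θ * lam * ρ + cR * ν * (α + ρ) := by ring

end Step

/-! ## §3 ★★★ The tower: the composed linear part stays within `(1 + 4gθ)·λᵐα₀` of `0` and within the leak profile of the flat orbit -/

section Tower

variable {𝔸 : Type*} [SeminormedAddCommGroup 𝔸]

/-- ★★★ **THE LEAKY LINEAR TOWER** ((143)∕(147) in sup-norm bookkeeping): levels `m ≤ k`, reader sets `S_m` (`|S_m| ≤ ν`), the composed linear part `a_m`, its flat orbit `e_m`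
(`‖e_m c′‖ ≤ λᵐα₀`) and the leak `r_m = a_m − e_m` (`r_0 = 0`, `r_{m+1} c = T♭_m r_m c + R_m a_m c` on `S_{m+1}`), with the flat-tube letter `‖T♭_m w c‖ ≤ Θλ·sup_S‖w‖`, the leak letter
`‖R_m w c‖ ≤ c_m·Σ_{S_m}‖w‖`, `c_m·ν ≤ λ·g·θ^{k−m}`, `Θθ ≤ ½`, `4gθ ≤ 1`: for all `m ≤ k` and all `c`, **`‖r_m c‖ ≤ 4g·θ^{k+1−m}·λᵐα₀`** and **`‖a_m c‖ ≤ (1 + 4gθ)·λᵐα₀`**.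
[cite: Balaban1985Averaging, (141)–(147) pp.39–40] -/
theorem leaky_tower_bound (k : ℕ) (ι : ℕ → Type*) (a e r : (m : ℕ) → ι m → 𝔸) (Tf R : (m : ℕ) → (ι m → 𝔸) → ι (m + 1) → 𝔸)
    (S : (m : ℕ) → Finset (ι m)) (cR : ℕ → ℝ) {Θ θ g lam α₀ : ℝ} {ν : ℕ}
    (hΘ : 0 ≤ Θ) (hθ : 0 ≤ θ) (hθ1 : θ ≤ 1) (hg : 0 ≤ g) (hlam : 0 ≤ lam) (hα₀ : 0 ≤ α₀) (hΘθ : Θ * θ ≤ 1 / 2) (hgθ : 4 * g * θ ≤ 1)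
    (hcR : ∀ m, m < k → 0 ≤ cR m) (hcRν : ∀ m, m < k → cR m * ν ≤ lam * g * θ ^ (k - m))
    (hae : ∀ m c, a m c = e m c + r m c) (hr0 : ∀ c, r 0 c = 0)
    (hrec : ∀ m, m < k → ∀ c ∈ S (m + 1), r (m + 1) c = Tf m (r m) c + R m (a m) c)
    (hT : ∀ m, m < k → ∀ c ∈ S (m + 1), ∀ (w : ι m → 𝔸) (β : ℝ), 0 ≤ β → (∀ c', c' ∉ S m → w c' = 0) →
      (∀ c' ∈ S m, ‖w c'‖ ≤ β) → ‖Tf m w c‖ ≤ Θ * lam * β)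
    (hR : ∀ m, m < k → ∀ c ∈ S (m + 1), ∀ w : ι m → 𝔸, (∀ c', c' ∉ S m → w c' = 0) → ‖R m w c‖ ≤ cR m * ∑ c' ∈ S m, ‖w c'‖)
    (hcard : ∀ m, m < k → (S m).card ≤ ν)
    (hSe : ∀ m, m ≤ k → ∀ c', c' ∉ S m → e m c' = 0) (hSr : ∀ m, m ≤ k → ∀ c', c' ∉ S m → r m c' = 0)
    (he : ∀ m, m ≤ k → ∀ c', ‖e m c'‖ ≤ lam ^ m * α₀) :
    ∀ m, m ≤ k → ∀ c, ‖r m c‖ ≤ 4 * g * θ ^ (k + 1 - m) * lam ^ m * α₀ ∧ ‖a m c‖ ≤ (1 + 4 * g * θ) * lam ^ m * α₀ := by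
  -- the sup profile of the leak
  have hprof : ∀ m, m ≤ k → ∀ c, ‖r m c‖ ≤ 4 * g * θ ^ (k + 1 - m) * lam ^ m * α₀ := by
    -- define the scalar profile as the recursion's right side and compare
    let ρ : ℕ → ℝ := fun m => Nat.rec (motive := fun _ => ℝ) 0 (fun m ρm => Θ * lam * ρm + lam * g * θ ^ (k - m) * (lam ^ m * α₀ + ρm)) m
    have hρ0 : ρ 0 = 0 := rfl
    have hρs : ∀ m, ρ (m + 1) = Θ * lam * ρ m + lam * g * θ ^ (k - m) * (lam ^ m * α₀ + ρ m) := fun m => rfl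
    have hρnn : ∀ m, 0 ≤ ρ m := by
      intro m
      induction m with
      | zero => rw [hρ0]
      | succ m ih => rw [hρs]; positivity
    have hρle := leak_profile_le ρ hΘ hθ hθ1 hg hlam hα₀ hΘθ hgθ hρ0 (fun m _ => (hρs m).le)
    -- `‖r m c‖ ≤ ρ m` by induction on `m`
    have hrρ : ∀ m, m ≤ k → ∀ c, ‖r m c‖ ≤ ρ m := by
      intro m
      induction m with
      | zero => intro _ c; rw [hr0 c, norm_zero, hρ0]
      | succ m ih =>
        intro hm c
        have hm' : m < k := Nat.lt_of_succ_le hm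
        by_cases hc : c ∈ S (m + 1)
        · have hstep := leak_step_bound (S m) (Tf m) (R m) (a m) (e m) (r m) (r (m + 1)) c (ν := ν)
            (hcR m hm') (by positivity : 0 ≤ lam ^ m * α₀) (hρnn m) (hrec m hm' c hc) (hT m hm' c hc) (hR m hm' c hc) (hcard m hm')
            (hae m) (hSe m hm'.le) (hSr m hm'.le) (fun c' _ => he m hm'.le c') (fun c' _ => ih hm'.le c')
          rw [hρs]
          refine hstep.trans ?_
          have h1 : cR m * ↑ν * (lam ^ m * α₀ + ρ m) ≤ lam * g * θ ^ (k - m) * (lam ^ m * α₀ + ρ m) :=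
            mul_le_mul_of_nonneg_right (hcRν m hm') (add_nonneg (by positivity) (hρnn m))
          linarith
        · rw [hSr (m + 1) hm c hc, norm_zero]; exact hρnn (m + 1)
    intro m hm c
    exact (hrρ m hm c).trans (hρle m hm)
  intro m hm c
  refine ⟨hprof m hm c, ?_⟩
  have h1 := hprof m hm c
  have hθp : θ ^ (k + 1 - m) ≤ θ := by
    have hkm : k + 1 - m = (k - m) + 1 := by omega
    rw [hkm, pow_succ]
    exact mul_le_of_le_one_left hθ (pow_le_one₀ hθ hθ1)
  have h2 : 4 * g * θ ^ (k + 1 - m) * lam ^ m * α₀ ≤ 4 * g * θ * lam ^ m * α₀ := by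
    have := mul_le_mul_of_nonneg_left hθp (by positivity : 0 ≤ 4 * g * (lam ^ m * α₀))
    nlinarith
  calc ‖a m c‖ = ‖e m c + r m c‖ := by rw [hae m c]
    _ ≤ ‖e m c‖ + ‖r m c‖ := norm_add_le _ _
    _ ≤ lam ^ m * α₀ + 4 * g * θ * lam ^ m * α₀ := add_le_add (he m hm c) (h1.trans h2)
    _ = (1 + 4 * g * θ) * lam ^ m * α₀ := by ring

/-- ★★ **… hence within `2λᵐα₀`** — the hypothesis `ha` of ✓`ChartKernelTower.kernel_tower_bound_le` at the exactly geometric `α_m := 2λᵐα₀` (print (147): «|Q_k(U₀; c, b)| ≦ 1 + 2C′₁α₀»).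
[cite: Balaban1985Averaging, (146)–(147) p.40] -/
theorem leaky_tower_bound_two (k : ℕ) (ι : ℕ → Type*) (a e r : (m : ℕ) → ι m → 𝔸) (Tf R : (m : ℕ) → (ι m → 𝔸) → ι (m + 1) → 𝔸)
    (S : (m : ℕ) → Finset (ι m)) (cR : ℕ → ℝ) {Θ θ g lam α₀ : ℝ} {ν : ℕ}
    (hΘ : 0 ≤ Θ) (hθ : 0 ≤ θ) (hθ1 : θ ≤ 1) (hg : 0 ≤ g) (hlam : 0 ≤ lam) (hα₀ : 0 ≤ α₀) (hΘθ : Θ * θ ≤ 1 / 2) (hgθ : 4 * g * θ ≤ 1)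
    (hcR : ∀ m, m < k → 0 ≤ cR m) (hcRν : ∀ m, m < k → cR m * ν ≤ lam * g * θ ^ (k - m))
    (hae : ∀ m c, a m c = e m c + r m c) (hr0 : ∀ c, r 0 c = 0)
    (hrec : ∀ m, m < k → ∀ c ∈ S (m + 1), r (m + 1) c = Tf m (r m) c + R m (a m) c)
    (hT : ∀ m, m < k → ∀ c ∈ S (m + 1), ∀ (w : ι m → 𝔸) (β : ℝ), 0 ≤ β → (∀ c', c' ∉ S m → w c' = 0) →
      (∀ c' ∈ S m, ‖w c'‖ ≤ β) → ‖Tf m w c‖ ≤ Θ * lam * β)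
    (hR : ∀ m, m < k → ∀ c ∈ S (m + 1), ∀ w : ι m → 𝔸, (∀ c', c' ∉ S m → w c' = 0) → ‖R m w c‖ ≤ cR m * ∑ c' ∈ S m, ‖w c'‖)
    (hcard : ∀ m, m < k → (S m).card ≤ ν)
    (hSe : ∀ m, m ≤ k → ∀ c', c' ∉ S m → e m c' = 0) (hSr : ∀ m, m ≤ k → ∀ c', c' ∉ S m → r m c' = 0)
    (he : ∀ m, m ≤ k → ∀ c', ‖e m c'‖ ≤ lam ^ m * α₀) :
    ∀ m, m ≤ k → ∀ c, ‖a m c‖ ≤ 2 * (lam ^ m * α₀) := by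
  intro m hm c
  have h := (leaky_tower_bound k ι a e r Tf R S cR hΘ hθ hθ1 hg hlam hα₀ hΘθ hgθ hcR hcRν hae hr0 hrec hT hR hcard hSe hSr he m hm c).2
  have h2 : (1 + 4 * g * θ) * lam ^ m * α₀ ≤ 2 * (lam ^ m * α₀) := by
    have : 0 ≤ lam ^ m * α₀ := by positivity
    nlinarith
  exact h.trans h2

end Tower

end Summit.QuantumFields.YangMills.Theorems.LeakyLinearTower
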